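import Summits.BirchSwinnertonDyer.BirchSwinnertonDyer.Theorems.CyclotomicUntwistPSRootNumberThree
import HarnessLib

/-!
# LAW L-w3, character form: `W₃(E) = η(−1)` for every character `η` mod `9` whose order is Kraus's inertia order —
# the sign in the route's analytic constant `κ = 9η(−1)/α²` is the local root number at `3`

Cell `pub/bsd-wall` (D-0145 line `route-BirchSwinnertonDyer-CyclotomicUntwist`), seat `bsd-line-cycu-p4` (width seat 4, gen 4).
Helper toward K1 `PSRankOneLowerHalfAtThree` (stmt-BirchSwinnertonDyer-21580) / K2 (stmt-21581). THEOREMS ONLY (no definition, no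
named fact, no `sorry`); BSD is not proved by this file and no crux is.

The route untwists by a Dirichlet character `η` mod `9` "of order `3` or `6` with `η|_inertia = χ`", i.e. `orderOf η = #Φ`, Kraus's
inertia order at `3` (`krausInertiaOrderThree W ∈ {3, 6}` on the cyclic rows, `PSKodairaDictionary.krausInertiaOrderThree_of_even`).
That identification is the route's context and is taken here as the DISPLAYED hypothesis `orderOf η = krausInertiaOrderThree W`;
under it the value `η(−1)` — which the typed value-at-one / rank-zero files of the line carry symbolically (`𝓛 0 0 =
α⁻²·9η(−1)·[0]⁺_f`, `CyclotomicUntwistFiniteSlopeValueAtOne`; D4 pin `κ = 9η(−1)/α²`, crux memo GZ3-NUMERIC-TEST-v2 §5) — IS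
the local root number of LAW L-w3:
* §1 characters mod `9` over a domain: `apply_neg_one_eq_one_of_pow_three_eq_one` (`η³ = 1 ⟹ η(−1) = 1`),
  `pow_three_eq_one_of_apply_neg_one_eq_one` (`η(−1) = 1 ⟹ η³ = 1`: every unit of `ℤ/9` cubes to `±1`), hence
  `apply_neg_one_eq_neg_one_of_orderOf_eq_six` and `apply_neg_one_eq_one_of_orderOf_eq_three`;
* §2 **`apply_neg_one_eq_rootNumberThree_of_psRow`**: on a PS row (`ClassO6 W 3`, `v₃Δ_min` even, `Δ′ ≡ 1 (mod 3)`), for every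
  `η : DirichletCharacter R 9` with `orderOf η = krausInertiaOrderThree W`: `(η (−1) : R) = W.rootNumberThree`.

References: O. G. Rizzo, Compositio Math. 136 (2003), Table II [Rizzo2003]; A. Kraus, Manuscripta Math. 69 (1990) [Kraus1990];
B. Mazur, J. Tate, J. Teitelbaum, Invent. Math. 84 (1986) §I.14 [MazurTateTeitelbaum1986Invent].
-/

open scoped Classical

open WeierstrassCurve Literature.NumberTheory.EllipticCurves Literature.NumberTheory.EllipticCurves.Rank1Residual
  Summit.BirchSwinnertonDyer.Rank1Residual.Additive

-- single-conjunct summit: `Summit.BirchSwinnertonDyer.BirchSwinnertonDyer.…` repeats the name by design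
set_option linter.dupNamespace false
set_option autoImplicit false

namespace Summit.BirchSwinnertonDyer.BirchSwinnertonDyer.Theorems.PSUntwistingCharacterSign

/-! ### §1 Characters mod `9`: `η(−1)` from the order of `η` -/

section Characters

variable {R : Type*} [CommRing R] (η : DirichletCharacter R 9)

/-- `η(−1)² = 1`. [folklore] -/
theorem apply_neg_one_sq : η (-1) * η (-1) = 1 := by
  rw [← map_mul, neg_mul_neg, one_mul, map_one]

/-- `η(−1) = ±1` (domain). [folklore] -/
theorem apply_neg_one_eq_one_or [IsDomain R] : η (-1) = 1 ∨ η (-1) = -1 :=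
  mul_self_eq_one_iff.mp (apply_neg_one_sq η)

/-- **`η³ = 1 ⟹ η(−1) = 1`** (`η(−1)³ = 1` and `η(−1)² = 1`). [folklore] -/
theorem apply_neg_one_eq_one_of_pow_three_eq_one (h3 : η ^ 3 = 1) : η (-1) = 1 := by
  have hu : IsUnit (-1 : ZMod 9) := isUnit_one.neg
  obtain ⟨u, hu'⟩ := hu
  have hcube : η (-1) ^ 3 = 1 := by
    rw [← hu', ← MulChar.pow_apply_coe, h3, MulChar.one_apply_coe]
  have hsq : η (-1) ^ 2 = 1 := by rw [pow_two]; exact apply_neg_one_sq η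
  calc η (-1) = η (-1) * η (-1) ^ 2 := by rw [hsq, mul_one]
    _ = η (-1) ^ 3 := by ring
    _ = 1 := hcube

/-- Every unit of `ℤ/9` cubes to `±1`. [folklore] -/
private theorem units_zmod_nine_pow_three (u : (ZMod 9)ˣ) : u ^ 3 = 1 ∨ u ^ 3 = -1 := by
  revert u; decide

/-- **`η(−1) = 1 ⟹ η³ = 1`**: `(η³)(u) = η(u³)` and `u³ = ±1` for every unit `u` of `ℤ/9`. [folklore] -/
theorem pow_three_eq_one_of_apply_neg_one_eq_one (h : η (-1) = 1) : η ^ 3 = 1 := by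
  apply MulChar.ext
  intro u
  rw [MulChar.pow_apply_coe, MulChar.one_apply_coe, ← map_pow, ← Units.val_pow_eq_pow_val]
  rcases units_zmod_nine_pow_three u with h1 | h1
  · rw [h1, Units.val_one, map_one]
  · rw [h1, Units.val_neg, Units.val_one, h]

/-- **Order `6` ⟹ `η(−1) = −1`.** [folklore] -/
theorem apply_neg_one_eq_neg_one_of_orderOf_eq_six [IsDomain R] (h6 : orderOf η = 6) : η (-1) = -1 := by
  rcases apply_neg_one_eq_one_or η with h | h
  · exfalso
    have hdvd : orderOf η ∣ 3 := orderOf_dvd_of_pow_eq_one (pow_three_eq_one_of_apply_neg_one_eq_one η h)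
    rw [h6] at hdvd
    omega
  · exact h

/-- **Order `3` ⟹ `η(−1) = 1`.** [folklore] -/
theorem apply_neg_one_eq_one_of_orderOf_eq_three (h3 : orderOf η = 3) : η (-1) = 1 :=
  apply_neg_one_eq_one_of_pow_three_eq_one η (by rw [← h3]; exact pow_orderOf_eq_one η)

end Characters

/-! ### §2 `η(−1)` is the local root number at `3` on the principal-series rows -/

section Curves

variable {R : Type*} [CommRing R] [IsDomain R]
  (W : WeierstrassCurve ℚ) [W.IsElliptic] [W.IsGloballyMinimal]

/-- **LAW L-w3, character form: `W₃(E) = η(−1)`** for every character `η` mod `9` (over any domain) whose order is Kraus's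
inertia order `#Φ ∈ {3, 6}` of the row — the route's untwisting character `η` (order `3` on Kodaira `II`/`II*`, order `6` on
`IV`/`IV*`): on a principal-series row (`ClassO6 W 3`, `v₃Δ_min` even, `Δ_min/3^v ≡ 1 (mod 3)`), `(η(−1) : R) = W₃`
(`PSRootNumberThree.rootNumberThree_eq_neg_one_iff_krausInertiaOrderThree_of_psRow` + §1). The identification
`orderOf η = #Φ` is the route's (displayed hypothesis `hη`), not proved here.
[cite: Rizzo2003, Table II (p. 4), rows (2,3,4), (3,5,6), (4,6,10), (1,2,0)] [cite: Kraus1990, Théorème (p = 3)]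
[cite: MazurTateTeitelbaum1986Invent, §I.14 (case p ∣ N, a_p ≠ 0)] -/
theorem apply_neg_one_eq_rootNumberThree_of_psRow (hO6 : ClassO6 W 3)
    (hev : Even (padicValInt 3 W.minimalDiscriminantInt))
    (hps : W.minimalDiscriminantInt / 3 ^ padicValInt 3 W.minimalDiscriminantInt % 3 = 1)
    (η : DirichletCharacter R 9) (hη : orderOf η = krausInertiaOrderThree W) :
    η (-1) = (W.rootNumberThree : R) := by
  have hiff := PSRootNumberThree.rootNumberThree_eq_neg_one_iff_krausInertiaOrderThree_of_psRow W hO6 hev hps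
  obtain ⟨h3, h6⟩ := PSKodairaDictionary.krausInertiaOrderThree_of_even W hO6.2.1 hO6.2.2 hev
  have h2 : padicValInt 3 W.minimalDiscriminantInt % 2 = 0 := Nat.even_iff.mp hev
  by_cases h4 : padicValInt 3 W.minimalDiscriminantInt % 4 = 2
  · -- `η` of order `6`, `W₃ = −1`
    have hk : krausInertiaOrderThree W = 6 := h6 h4
    rw [hiff.mpr hk, apply_neg_one_eq_neg_one_of_orderOf_eq_six η (hη.trans hk)]
    push_cast; ring
  · -- `η` of order `3`, `W₃ = +1`
    have hk : krausInertiaOrderThree W = 3 := h3 (Nat.dvd_of_mod_eq_zero (by omega))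
    have hW : W.rootNumberThree = 1 := by
      rcases W.rootNumberThree_eq_one_or_eq_neg_one with h | h
      · exact h
      · exact absurd (hiff.mp h) (by rw [hk]; norm_num)
    rw [hW, apply_neg_one_eq_one_of_orderOf_eq_three η (hη.trans hk)]
    push_cast; rfl

end Curves

end Summit.BirchSwinnertonDyer.BirchSwinnertonDyer.Theorems.PSUntwistingCharacterSign
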